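/-
Copyright (c) 2026 the pub-hodgecm-mathlib formalisation cell (harness21).  Prover seat hodgecm-mathlib-LH1-p01 (g12) on the N8-INNER road (row 2 `stub_N8`, road owner
LH2-plan (g1), DEAL #1 brick (5) «J′-TRANSPORT»), FILE C: the junction of (5) with ★ (6) FORWARD — ONE jump datum for both groups; 2026-09-02.
-/
import Literature.NumberTheory.Rogawski1990.ArchJumpConstInnerTransport      -- (this seat) FILE B ★ p851927: `archHcJump_const_eq_of_innerForms_of_mem_splitChartPlaces`, `isCoveredWall_of_mem_splitChartPlaces`; brings FILE A, CUT B
import Literature.NumberTheory.Rogawski1990.ArchHCSpaceGInnerTransport       -- ★ p851918 (LH3-p03 (g7)) brick (6) FORWARD: `archHCSpaceG_innerTransport_of_archHCSpaceG` (the `jc″` slot), `slotSign_eq_slotSign_of_not_mem_splitChartPlaces`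
import Literature.NumberTheory.Rogawski1990.ArchInnerTwistChartDictionary    -- ★ p851905 (LH7-p04 (g8)) brick (3): `mem_splitChartPlaces_quasiSplitWeights`
import HarnessLib

/-!
# (5)∘(6): the transported `G′`-families and the genuine `G`-families lie in ONE Harish-Chandra space of the `β`-atlas — the same jump datum for both
# (Shelstad 1979 §4 Thm. 4.7; Bouaziz 1994 §3.2; Rogawski 1990 §14.2 (14.2.1))

Topic `NumberTheory/Rogawski1990`; namespace `Literature.NumberTheory.Rogawski1990`.  THEOREMS ONLY (no definition, no instance, no notation, no axiom, no named fact, no `sorry`);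
kernel lane `--kind proof --supports stmt-HodgeConjecture-24833`.  Cell `pub/hodgecm-mathlib`, crux H413 = `stmt-HodgeConjecture-24833`; N8-INNER road (LEAD F0P3a-plan (g15)
T14-4, road owner LH2-plan (g1) DEAL #1), brick **(5) «J′-TRANSPORT»**, FILE C of three (A = ★ p851911 `ArchOrbFamGExtJumpSideGNondeg`, B = ★ p851927 `ArchJumpConstInnerTransport`).
Author LH1-p01 (g12).

WHY.  Brick (6) FORWARD (★ p851918 `archHCSpaceG_innerTransport_of_archHCSpaceG`) moves a `G′`-family `orbFamGExt L α ν′ a′ ∈ ArchHCSpaceG (slotSign L α) jc′` to the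
`β`-atlas with ANY datum `jc″` satisfying `hjc : ∀ S′ w i j, w ∉ S′ → w ∈ splitChartPlaces L α → jc″ S′ w i j = jc′ S′ w i j` — an identity at EVERY chart `S′` and EVERY pair,
whereas brick (5) (FILE B `archHcJump_const_eq_of_innerForms`) identifies two VALID data only where they are READ: `α`-admissible `S′`, covered `w`, noncompact pair.  Off that
read set the CUT B witness is `0` by construction while a valid `G`-datum is pinned non-zero (an `α`-non-admissible chart is still `β`-admissible), so `hjc` cannot hold between
the raw data.  The cure is free: PATCH the `G′`-datum off its read set — `jc₁′ := jc₁` on (`α`-admissible `S′`, `w ∈ splitChartPlaces L α`, `i ≠ j`, `slotSign w i ≠ slotSign w j`)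
and `:= jc₂` elsewhere — which is STILL VALID for every `G′`-test function (★ `orbFamGExt_of_not_admissible`: both members vanish on a non-admissible chart; the guard of ★
`ArchHcJump` excludes the rest) and satisfies (6)'s `hjc` against `jc″ := jc₂` TOKEN FOR TOKEN by (5).  Consequence (the form brick (11) consumes): for ONE datum `jc_G` valid
for all test functions of `G_∞ = U(diag β)_∞`, `β = (½, 1, −½)`, EVERY transported `G′`-family lies in `ArchHCSpaceG (slotSign L β) jc_G` as well — FORWARD and SURJ-G now
quantify over the same space with the same constants.
* §1 **`exists_archHCSpaceG_patch`** — two nondegenerate frames `α₁, α₂` over `L`, `α₂` split at every place, valid data `jc₁, jc₂`: `∃ jc₁′` valid on `α₁` with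
  `∀ S′ w i j, w ∉ S′ → w ∈ splitChartPlaces L α₁ → jc₂ S′ w i j = jc₁′ S′ w i j`.
* §2 **`archHCSpaceG_innerTransport_of_valid`** — at `β`: for every `jc_G` valid for all `G`-test functions, every `G′`-family `orbFamGExt L α ν′ a′` lies in
  `ArchHCSpaceG (slotSign L β) jc_G`; **`exists_archHCSpaceG_innerTransport_pinned`** — `∃ jc_G` carrying BOTH the `G`-families and the transported `G′`-families.
HONEST LABEL: HC_CM is proved only modulo the 7 printed citations (2 remaining: hLiu418 = `stmt-HodgeConjecture-24832`, h413 = `stmt-HodgeConjecture-24833`) until rung 0 closes;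
count-neutral (no leaf, no letter, no books row moves; row 2 stays PRINT until (Sh)′ is ★ and ED. 43 re-keys 27456).

## References
* [Shelstad1979] D. Shelstad, *Characters and inner forms of a quasi-split group over ℝ*, Compositio Math. 39 (1979), §4 p. 20, Prop. 4.5 p. 26, Thm. 4.7 (IIIb) p. 31.
* [Bouaziz1994IntegralesOrbitales] A. Bouaziz, *Intégrales orbitales sur les groupes de Lie réductifs*, Ann. Sci. ÉNS (4) 27 (1994), §3.2 (I₃) p. 580, Thm. 3.2.1 p. 581.
* [Rogawski1990] J. D. Rogawski, *Automorphic Representations of Unitary Groups in Three Variables*, Ann. of Math. Stud. 123 (1990), §14.1 p. 232, §14.2 (14.2.1) pp. 232–233.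
-/

set_option autoImplicit false

noncomputable section

open MeasureTheory MeasureTheory.Measure NumberField NumberField.InfinitePlace Matrix Complex Set Filter Topology
open scoped MatrixGroups Matrix Real Classical ENNReal NNReal ContDiff
open Literature.NumberTheory.Automorphic Literature.NumberTheory.Automorphic.UnitaryGroup Literature.NumberTheory.Automorphic.ArchCartan
open Literature.NumberTheory.Automorphic.Shelstad1979.StableOrbitalIntegrals
open Literature.NumberTheory.GaloisRepresentations Literature.MeasureTheory.Group

namespace Literature.NumberTheory.Rogawski1990

/-! ## §1 Patching a valid `G′`-datum off its read set -/

section Patch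

variable (L : Type) [Field L] [NumberField L] [IsCMField L]
  (α₁ : Fin 3 → L)
  [MeasurableSpace ↥(arch (↥(maximalRealSubfield L)) L (IsCMField.complexConj L) 3 (Matrix.diagonal α₁))] [BorelSpace ↥(arch (↥(maximalRealSubfield L)) L (IsCMField.complexConj L) 3 (Matrix.diagonal α₁))]
  (ν₁ : Measure ↥(arch (↥(maximalRealSubfield L)) L (IsCMField.complexConj L) 3 (Matrix.diagonal α₁))) [ν₁.IsHaarMeasure] [ν₁.IsMulRightInvariant]
  (α₂ : Fin 3 → L)
  [MeasurableSpace ↥(arch (↥(maximalRealSubfield L)) L (IsCMField.complexConj L) 3 (Matrix.diagonal α₂))] [BorelSpace ↥(arch (↥(maximalRealSubfield L)) L (IsCMField.complexConj L) 3 (Matrix.diagonal α₂))]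
  (ν₂ : Measure ↥(arch (↥(maximalRealSubfield L)) L (IsCMField.complexConj L) 3 (Matrix.diagonal α₂))) [ν₂.IsHaarMeasure] [ν₂.IsMulRightInvariant]

/-- **PATCHING A VALID `G′`-DATUM OFF ITS READ SET.**  Two nondegenerate real diagonal frames `α₁, α₂` over the same CM field, `α₂` a split-chart place everywhere (`hall₂`; the
quasi-split weights: ★ `mem_splitChartPlaces_quasiSplitWeights`), `jc₁` valid for all test functions on `U(diag α₁)_∞`, `jc₂` valid for all test functions on `U(diag α₂)_∞`.  Then
`jc₁′ := jc₁` on the READ set of the `α₁`-atlas (`α₁`-admissible chart, `w ∈ splitChartPlaces L α₁`, noncompact ordered pair) and `:= jc₂` elsewhere is STILL valid for every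
`α₁`-test function (off the read set both chart members vanish, ★ `orbFamGExt_of_not_admissible`, or the guard fails, ★ `slotSign_eq_slotSign_of_not_mem_splitChartPlaces`), and
`jc₂ = jc₁′` at EVERY `(S′, w ∉ S′, w ∈ splitChartPlaces L α₁, i, j)` — on the read set by (5) ★ `archHcJump_const_eq_of_innerForms_of_mem_splitChartPlaces`, elsewhere by
definition.  This is ★ (6) `archHCSpaceG_innerTransport_of_archHCSpaceG`'s `hjc` with `jc″ := jc₂`. [cite: Shelstad1979, Thm. 4.7 (IIIb) (p. 31)]
[cite: Bouaziz1994IntegralesOrbitales, §3.2 (I₃) p. 580] [cite: Rogawski1990, §14.2 (14.2.1) pp. 232–233] -/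
theorem exists_archHCSpaceG_patch
    (hherm₁ : ((Matrix.diagonal α₁).map (cmConjRingHom L)).transpose = Matrix.diagonal α₁) (hα₁ : ∀ i, α₁ i ≠ 0)
    {jc₁ : Finset {w : InfinitePlace L // IsComplex w} → {w : InfinitePlace L // IsComplex w} → Fin 3 → Fin 3 → ℂ}
    (hHC₁ : ∀ a : ↥(arch (↥(maximalRealSubfield L)) L (IsCMField.complexConj L) 3 (Matrix.diagonal α₁)) → ℂ,
      ArchSmooth L 3 (Matrix.diagonal α₁) a → ArchHCSpaceG (slotSign L α₁) jc₁ (orbFamGExt L α₁ ν₁ a))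
    (hherm₂ : ((Matrix.diagonal α₂).map (cmConjRingHom L)).transpose = Matrix.diagonal α₂) (hα₂ : ∀ i, α₂ i ≠ 0)
    {jc₂ : Finset {w : InfinitePlace L // IsComplex w} → {w : InfinitePlace L // IsComplex w} → Fin 3 → Fin 3 → ℂ}
    (hHC₂ : ∀ a : ↥(arch (↥(maximalRealSubfield L)) L (IsCMField.complexConj L) 3 (Matrix.diagonal α₂)) → ℂ,
      ArchSmooth L 3 (Matrix.diagonal α₂) a → ArchHCSpaceG (slotSign L α₂) jc₂ (orbFamGExt L α₂ ν₂ a))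
    (hall₂ : ∀ w : {w : InfinitePlace L // IsComplex w}, w ∈ splitChartPlaces L α₂) :
    ∃ jc₁' : Finset {w : InfinitePlace L // IsComplex w} → {w : InfinitePlace L // IsComplex w} → Fin 3 → Fin 3 → ℂ,
      (∀ a : ↥(arch (↥(maximalRealSubfield L)) L (IsCMField.complexConj L) 3 (Matrix.diagonal α₁)) → ℂ,
          ArchSmooth L 3 (Matrix.diagonal α₁) a → ArchHCSpaceG (slotSign L α₁) jc₁' (orbFamGExt L α₁ ν₁ a)) ∧
        ∀ (S' : Finset {w : InfinitePlace L // IsComplex w}) (w : {w : InfinitePlace L // IsComplex w}) (i j : Fin 3),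
          w ∉ S' → w ∈ splitChartPlaces L α₁ → jc₂ S' w i j = jc₁' S' w i j := by
  have hreal₁ : ∀ (w : {w : InfinitePlace L // IsComplex w}) (k : Fin 3), (w.1.embedding (α₁ k)).im = 0 :=
    fun w k => im_embedding_diagonal_eq_zero L 3 α₁ (complexConj_apply_eq_of_diagonal_frame hherm₁) w k
  refine ⟨fun S' w i j => if (∀ v, v ∈ S' → v ∈ splitChartPlaces L α₁) ∧ w ∈ splitChartPlaces L α₁ ∧ i ≠ j ∧ slotSign L α₁ w i ≠ slotSign L α₁ w j
      then jc₁ S' w i j else jc₂ S' w i j, fun a ha => ?_, fun S' w i j hw hw₁ => ?_⟩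
  · -- validity of the patched datum: only the (I₃) conjunct reads the datum
    obtain ⟨hP, hW, hSm, hC, hJ⟩ := hHC₁ a ha
    refine ⟨hP, hW, hSm, hC, fun S' w hw i j hij hsij p hp n m => ?_⟩
    by_cases hadm : ∀ v, v ∈ S' → v ∈ splitChartPlaces L α₁
    · -- admissible chart: the guard forces a split-chart place, and the patch reads `jc₁`
      have hw₁ : w ∈ splitChartPlaces L α₁ := by
        by_contra hw'
        exact hsij (slotSign_eq_slotSign_of_not_mem_splitChartPlaces L α₁ hα₁ (hreal₁ w) hw' i j)
      have h := hJ S' w hw i j hij hsij p hp n m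
      simp only [if_pos (show (∀ v, v ∈ S' → v ∈ splitChartPlaces L α₁) ∧ w ∈ splitChartPlaces L α₁ ∧ i ≠ j ∧ slotSign L α₁ w i ≠ slotSign L α₁ w j from
        ⟨hadm, hw₁, hij, hsij⟩)]
      exact h
    · -- non-admissible chart: both members vanish identically
      have hadm' : ¬ ∀ v, v ∈ insert w S' → v ∈ splitChartPlaces L α₁ :=
        fun h => hadm fun v hv => h v (Finset.mem_insert_of_mem hv)
      rw [orbFamGExt_of_not_admissible L α₁ ν₁ a S' hadm, orbFamGExt_of_not_admissible L α₁ ν₁ a (insert w S') hadm']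
      refine ⟨0, 0, ?_, ?_, ?_⟩
      · simp only [hcTwistedDeriv_fun_zero]; exact tendsto_const_nhds
      · simp only [hcTwistedDeriv_fun_zero]; exact tendsto_const_nhds
      · rw [hcTwistedDeriv_fun_zero, mul_zero, sub_zero]
  · -- the identity: on the read set by (5), elsewhere by definition
    by_cases h : (∀ v, v ∈ S' → v ∈ splitChartPlaces L α₁) ∧ w ∈ splitChartPlaces L α₁ ∧ i ≠ j ∧ slotSign L α₁ w i ≠ slotSign L α₁ w j
    · beta_reduce
      rw [if_pos h]
      obtain ⟨hadm, -, hij, hsij⟩ := h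
      exact (archHcJump_const_eq_of_innerForms_of_mem_splitChartPlaces L α₁ ν₁ α₂ ν₂ hherm₁ hα₁ hHC₁ hherm₂ hα₂ hHC₂ S' w hadm
        (fun v _ => hall₂ v) hw hw₁ (hall₂ w) hij hsij).symm
    · beta_reduce
      rw [if_neg h]

end Patch

/-! ## §2 At the quasi-split weights: ONE datum for the `G`-families and the transported `G′`-families -/

section QuasiSplit

variable (L : Type) [Field L] [NumberField L] [IsCMField L]
  (α : Fin 3 → L)
  [MeasurableSpace ↥(arch (↥(maximalRealSubfield L)) L (IsCMField.complexConj L) 3 (Matrix.diagonal α))] [BorelSpace ↥(arch (↥(maximalRealSubfield L)) L (IsCMField.complexConj L) 3 (Matrix.diagonal α))]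
  (ν' : Measure ↥(arch (↥(maximalRealSubfield L)) L (IsCMField.complexConj L) 3 (Matrix.diagonal α))) [ν'.IsHaarMeasure] [ν'.IsMulRightInvariant]
  [MeasurableSpace ↥(arch (↥(maximalRealSubfield L)) L (IsCMField.complexConj L) 3 (Matrix.diagonal ![(2 : L)⁻¹, 1, -(2 : L)⁻¹]))]
  [BorelSpace ↥(arch (↥(maximalRealSubfield L)) L (IsCMField.complexConj L) 3 (Matrix.diagonal ![(2 : L)⁻¹, 1, -(2 : L)⁻¹]))]
  (ν : Measure ↥(arch (↥(maximalRealSubfield L)) L (IsCMField.complexConj L) 3 (Matrix.diagonal ![(2 : L)⁻¹, 1, -(2 : L)⁻¹]))) [ν.IsHaarMeasure] [ν.IsMulRightInvariant]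

/-- **EVERY VALID `G`-DATUM CARRIES THE TRANSPORTED `G′`-FAMILIES.**  `diag α` a nondegenerate real diagonal frame (`hherm`, `hα`) of the inner form `G′_∞`, `β = (½, 1, −½)` the
quasi-split weights of `G_∞ = U(Φ₃)_∞` (★ `formCongr_quasiSplitFrame_diagonal`), `ν′, ν` Haar measures.  If `jc_G` is valid for ALL test functions of `G_∞`
(`orbFamGExt L β ν f ∈ ArchHCSpaceG (slotSign L β) jc_G`), then for every `a′ ∈ C_c^∞(G′_∞)` the zero-extended family `orbFamGExt L α ν′ a′` lies in `ArchHCSpaceG (slotSign L β) jc_G`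
too: CUT B on `α` (★ `exists_jc_archHCSpaceG_orbFamGExt_of_ne_zero`) + the patch of §1 (★ `quasiSplitWeights_ne_zero`, ★ `transpose_map_cmConjRingHom_diagonal_quasiSplitWeights`,
★ `mem_splitChartPlaces_quasiSplitWeights`) + ★ (6) `archHCSpaceG_innerTransport_of_archHCSpaceG`. [cite: Shelstad1979, §4 p. 20; Thm. 4.7 (IIIb) (p. 31)]
[cite: Bouaziz1994IntegralesOrbitales, §3.2 p. 580; Thm. 3.2.1 p. 581] [cite: Rogawski1990, §14.2 (14.2.1) pp. 232–233] -/
theorem archHCSpaceG_innerTransport_of_valid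
    (hherm : ((Matrix.diagonal α).map (cmConjRingHom L)).transpose = Matrix.diagonal α) (hα : ∀ i, α i ≠ 0)
    {jcG : Finset {w : InfinitePlace L // IsComplex w} → {w : InfinitePlace L // IsComplex w} → Fin 3 → Fin 3 → ℂ}
    (hG : ∀ f : ↥(arch (↥(maximalRealSubfield L)) L (IsCMField.complexConj L) 3 (Matrix.diagonal ![(2 : L)⁻¹, 1, -(2 : L)⁻¹])) → ℂ,
      ArchSmooth L 3 (Matrix.diagonal ![(2 : L)⁻¹, 1, -(2 : L)⁻¹]) f →
        ArchHCSpaceG (slotSign L ![(2 : L)⁻¹, 1, -(2 : L)⁻¹]) jcG (orbFamGExt L ![(2 : L)⁻¹, 1, -(2 : L)⁻¹] ν f))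
    {a' : ↥(arch (↥(maximalRealSubfield L)) L (IsCMField.complexConj L) 3 (Matrix.diagonal α)) → ℂ} (ha' : ArchSmooth L 3 (Matrix.diagonal α) a') :
    ArchHCSpaceG (slotSign L ![(2 : L)⁻¹, 1, -(2 : L)⁻¹]) jcG (orbFamGExt L α ν' a') := by
  have hreal : ∀ (w : {w : InfinitePlace L // IsComplex w}) (k : Fin 3), (w.1.embedding (α k)).im = 0 :=
    fun w k => im_embedding_diagonal_eq_zero L 3 α (complexConj_apply_eq_of_diagonal_frame hherm) w k
  obtain ⟨jc₁, hjc₁⟩ := exists_jc_archHCSpaceG_orbFamGExt_of_ne_zero L α ν' hherm hα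
  obtain ⟨jc₁', hval, hjc⟩ := exists_archHCSpaceG_patch L α ν' (![(2 : L)⁻¹, 1, -(2 : L)⁻¹]) ν hherm hα hjc₁
    (transpose_map_cmConjRingHom_diagonal_quasiSplitWeights L) (quasiSplitWeights_ne_zero L) hG (mem_splitChartPlaces_quasiSplitWeights L)
  exact archHCSpaceG_innerTransport_of_archHCSpaceG L α ν' hα hreal hjc (hval a' ha')

/-- **ONE DATUM FOR BOTH GROUPS** (the form the junction brick (11) consumes): there is a jump datum `jc_G` such that EVERY genuine `G`-family `orbFamGExt L β ν f` AND EVERY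
transported `G′`-family `orbFamGExt L α ν′ a′` lies in `ArchHCSpaceG (slotSign L β) jc_G` — FORWARD and SURJ-G quantify over one space with one set of constants.
[cite: Shelstad1979, §4 p. 20; Thm. 4.7 (IIIb) (p. 31)] [cite: Bouaziz1994IntegralesOrbitales, §3.2 p. 580; Thm. 3.2.1 p. 581] [cite: Rogawski1990, §14.2 (14.2.1) pp. 232–233] -/
theorem exists_archHCSpaceG_innerTransport_pinned
    (hherm : ((Matrix.diagonal α).map (cmConjRingHom L)).transpose = Matrix.diagonal α) (hα : ∀ i, α i ≠ 0) :
    ∃ jcG : Finset {w : InfinitePlace L // IsComplex w} → {w : InfinitePlace L // IsComplex w} → Fin 3 → Fin 3 → ℂ,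
      (∀ f : ↥(arch (↥(maximalRealSubfield L)) L (IsCMField.complexConj L) 3 (Matrix.diagonal ![(2 : L)⁻¹, 1, -(2 : L)⁻¹])) → ℂ,
          ArchSmooth L 3 (Matrix.diagonal ![(2 : L)⁻¹, 1, -(2 : L)⁻¹]) f →
            ArchHCSpaceG (slotSign L ![(2 : L)⁻¹, 1, -(2 : L)⁻¹]) jcG (orbFamGExt L ![(2 : L)⁻¹, 1, -(2 : L)⁻¹] ν f)) ∧
        ∀ a' : ↥(arch (↥(maximalRealSubfield L)) L (IsCMField.complexConj L) 3 (Matrix.diagonal α)) → ℂ,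
          ArchSmooth L 3 (Matrix.diagonal α) a' → ArchHCSpaceG (slotSign L ![(2 : L)⁻¹, 1, -(2 : L)⁻¹]) jcG (orbFamGExt L α ν' a') := by
  obtain ⟨jcG, hG⟩ := exists_jc_archHCSpaceG_orbFamGExt_of_ne_zero L (![(2 : L)⁻¹, 1, -(2 : L)⁻¹]) ν
    (transpose_map_cmConjRingHom_diagonal_quasiSplitWeights L) (quasiSplitWeights_ne_zero L)
  exact ⟨jcG, hG, fun a' ha' => archHCSpaceG_innerTransport_of_valid L α ν' ν hherm hα hG ha'⟩

end QuasiSplit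

end Literature.NumberTheory.Rogawski1990

end
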